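import Mathlib
import Summits.ResolutionOfSingularities.ResolutionOfSingularities.Theorems.WeightedInvariantLocalWeightedDropNCPolyBridgeRepresents

/-!
# `WeightedInvariant.LocalWeightedDrop`, TOT2-LINE piece S-E2′ (the count-game bridge), part 1b: SLICES of the point chart, the `y`-scaling and the
# extension of plane changes (coordinate bookkeeping for the point move)

Crux item stmt-ResolutionOfSingularities-8899 `LocalWeightedDrop` (route `ResolutionOfSingularities/WeightedInvariant`), ENGINE skeleton v32
(ddb48572591139d5), registered stub `stub_spaceNCRankDrop`; TOT2-LINE v1.1 §(E) piece S-E2′ (`L/res-L1-w43-lead-1/g4/TOT2-LINE.md`).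
[OURS · L1 W4.3 · chain w43 · lead-1 gen 4.  Port of the point half of the weighted-game bridge (ρ-B) of the line «monic polyhedron descent»
(res-D-pv-058 AS stub-6 / res-type-061: …PolyDescentBridgeSlices; stub worker 3's brick …MonicPointBlowup) from `CobordantGame` successors to the
successors of the NC count game (`TameFourTupleDrop.MoveClause`, res-type-056).  MODEL: Cossart–Jannsen–Saito LNM 2270 §11 Case 1 (point blow-up,
near points on the line `ℙ(Dir)`, Lemmas 11.1/11.2); Perlega arXiv:2011.14443 §7.1 (apposite parameters).  Nothing here is a statement of any
manuscript; the games are the programme's own.  AI-produced, gate-checked, weaker than expert review.]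

* `bdry_eq`, `planes_eq` — two-factor forms over `N ⊆ Fin 2`;
* `slice_zero_planes`, `slice_one_planes`, `slice_last_planes`, `slice_prod` — the slices `y′_i ↦ 0` of the transformed planes at the three slots;
* `yScale γ` (`y ↦ γy`), `extendLast τ` (a plane change extended by `y ↦ y`): zero constants, determinants, action on `monicGerm`
  (`subst_yScale_monicGerm`: `(γ^{d−j} T_j)_j ↦ γ^d · monicGerm T`; `subst_extendLast_monicGerm`: coefficientwise).
-/

set_option linter.dupNamespace false -- mandated namespace of this single-conjunct summit

noncomputable section

namespace Summit.ResolutionOfSingularities.ResolutionOfSingularities.Theorems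

namespace NCPoly

open MvPowerSeries Literature.AlgebraicGeometry.Resolution TameFourTupleDrop

variable {k : Type} [Field k]

/-! ## Two-factor forms of the boundary products (`N ⊆ Fin 2`) -/

/-- A product over `N ⊆ Fin 2` as a product of two `if`s. -/
theorem prod_fin_two_subset {M : Type*} [CommMonoid M] (N : Finset (Fin 2)) (f : Fin 2 → M) :
    ∏ l ∈ N, f l = (if (0 : Fin 2) ∈ N then f 0 else 1) * (if (1 : Fin 2) ∈ N then f 1 else 1) := by
  classical
  have h : ∏ l ∈ N, f l = ∏ l : Fin 2, (if l ∈ N then f l else 1) := by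
    rw [← Finset.prod_filter, Finset.filter_mem_eq_inter, Finset.univ_inter]
  rw [h, Fin.prod_univ_two]

/-- `bdry N = [u₁] · [u₂]`. -/
theorem bdry_eq (N : Finset (Fin 2)) :
    (bdry N : MvPowerSeries (Fin 3) k) = (if (0 : Fin 2) ∈ N then X 0 else 1) * (if (1 : Fin 2) ∈ N then X 1 else 1) := by
  rw [bdry, prod_fin_two_subset]
  rfl

/-- `planes N pt = [c₀ + y′₀] · [c₁ + y′₁]`. -/
theorem planes_eq (N : Finset (Fin 2)) (pt : Fin 3 → k) :
    planes N pt = (if (0 : Fin 2) ∈ N then C (pt 0) + X 1 else 1) * (if (1 : Fin 2) ∈ N then C (pt 1) + X 2 else 1) := by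
  rw [planes, prod_fin_two_subset]
  rfl

/-! ## Slices at the slot `u₁` (index `0`) of the four chart variables `(s, y′₀, y′₁, y′)` -/

section SliceZero

/-- `y′₁ ↦ X 1` under the slice at `0`. -/
theorem slice_zero_X_two : TupleGame.slice (0 : Fin 3) (X 2 : MvPowerSeries (Fin (3 + 1)) k) = X 1 := by
  unfold TupleGame.slice
  rw [subst_X (CobordantChartPlaneSlice.hasSubst_slice _), if_neg (by decide)]
  rfl

/-- The slice at `0` of the planes: `[c₀] · [c₁ + u₂]`. -/
theorem slice_zero_planes (N : Finset (Fin 2)) (pt : Fin 3 → k) :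
    TupleGame.slice (0 : Fin 3) (planes N pt) =
      (if (0 : Fin 2) ∈ N then C (pt 0) else 1) * (if (1 : Fin 2) ∈ N then C (pt 1) + X 1 else 1) := by
  have h1 : TupleGame.slice (0 : Fin 3) (1 : MvPowerSeries (Fin (3 + 1)) k) = 1 := by
    rw [← map_one (C : k →+* MvPowerSeries (Fin (3 + 1)) k), WildTerminal.slice_C, map_one]
  rw [planes_eq, slice_mul]
  congr 1
  · split_ifs
    · rw [TupleMonomialPhase.slice_add, WildTerminal.slice_C, show (1 : Fin (3 + 1)) = (0 : Fin 3).succ from rfl,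
        WildTerminal.slice_X_succ_self, add_zero]
    · exact h1
  · split_ifs
    · rw [TupleMonomialPhase.slice_add, WildTerminal.slice_C, slice_zero_X_two]
    · exact h1

end SliceZero

section SliceOne

/-- `y′₀ ↦ X 1` under the slice at `1`. -/
theorem slice_one_X_one : TupleGame.slice (1 : Fin 3) (X 1 : MvPowerSeries (Fin (3 + 1)) k) = X 1 := by
  unfold TupleGame.slice
  rw [subst_X (CobordantChartPlaneSlice.hasSubst_slice _), if_neg (by decide)]
  rfl

/-- `y′₁ ↦ 0` under the slice at `1`. -/
theorem slice_one_X_two : TupleGame.slice (1 : Fin 3) (X 2 : MvPowerSeries (Fin (3 + 1)) k) = 0 := by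
  rw [show (2 : Fin (3 + 1)) = (1 : Fin 3).succ from rfl, WildTerminal.slice_X_succ_self]

/-- The slice at `1` of the planes: `[c₀ + u] · [c₁]`. -/
theorem slice_one_planes (N : Finset (Fin 2)) (pt : Fin 3 → k) :
    TupleGame.slice (1 : Fin 3) (planes N pt) =
      (if (0 : Fin 2) ∈ N then C (pt 0) + X 1 else 1) * (if (1 : Fin 2) ∈ N then C (pt 1) else 1) := by
  have h1 : TupleGame.slice (1 : Fin 3) (1 : MvPowerSeries (Fin (3 + 1)) k) = 1 := by
    rw [← map_one (C : k →+* MvPowerSeries (Fin (3 + 1)) k), WildTerminal.slice_C, map_one]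
  rw [planes_eq, slice_mul]
  congr 1
  · split_ifs
    · rw [TupleMonomialPhase.slice_add, WildTerminal.slice_C, slice_one_X_one]
    · exact h1
  · split_ifs
    · rw [TupleMonomialPhase.slice_add, WildTerminal.slice_C, slice_one_X_two, add_zero]
    · exact h1

end SliceOne

/-- The slice is multiplicative over finite products. -/
theorem slice_prod {m : ℕ} (i : Fin (m + 1)) {ι : Type*} (s : Finset ι) (f : ι → MvPowerSeries (Fin (m + 1 + 1)) k) :
    TupleGame.slice i (∏ l ∈ s, f l) = ∏ l ∈ s, TupleGame.slice i (f l) := by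
  unfold TupleGame.slice
  rw [← coe_substAlgHom (CobordantChartPlaneSlice.hasSubst_slice (R := k) i), map_prod]

/-- The slice at the `y`-slot `Fin.last 2` of the planes: `∏_{l ∈ N} (c_l + X l.succ)`. -/
theorem slice_last_planes (N : Finset (Fin 2)) (pt : Fin 3 → k) :
    TupleGame.slice (Fin.last 2) (planes N pt) = ∏ l ∈ N, (C (pt (Fin.castSucc l)) + X l.succ : MvPowerSeries (Fin 3) k) := by
  rw [planes, slice_prod]
  refine Finset.prod_congr rfl fun l _ => ?_
  rw [TupleMonomialPhase.slice_add, WildTerminal.slice_C, show (Fin.castSucc l).succ = ((Fin.last 2).succAbove l).succ by rw [Fin.succAbove_last],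
    TupleMonomialPhase.slice_X_succ_succAbove]

/-! ## The `y`-scaling -/

/-- The coordinate change `y ↦ γ y` (planes fixed). -/
def yScale (γ : k) : Fin 3 → MvPowerSeries (Fin 3) k :=
  fun l => if l = Fin.last 2 then C γ * X l else X l

/-- `yScale` has zero constant terms. -/
theorem constantCoeff_yScale (γ : k) (l : Fin 3) : constantCoeff (yScale γ l) = 0 := by
  unfold yScale
  split_ifs
  · rw [map_mul, constantCoeff_X, mul_zero]
  · exact constantCoeff_X l

/-- The linear part of `yScale γ` has determinant `γ`. -/
theorem det_linMat_yScale (γ : k) : (FormalCoordChange.linMat (yScale γ)).det = γ := by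
  have hM : FormalCoordChange.linMat (yScale γ) = Matrix.diagonal (fun j : Fin 3 => if j = Fin.last 2 then γ else 1) := by
    ext i j
    rw [FormalCoordChange.linMat, Matrix.of_apply, Matrix.diagonal_apply, yScale]
    by_cases hi : i = Fin.last 2
    · simp only [hi, if_true, coeff_C_mul, coeff_X, Finsupp.single_eq_single_iff, one_ne_zero, and_true,
        and_self, or_false]
      by_cases hj : Fin.last 2 = j
      · subst hj; simp
      · rw [if_neg (fun h => hj h.symm), if_neg hj, mul_zero]
    · simp only [if_neg hi, coeff_X, Finsupp.single_eq_single_iff, one_ne_zero, and_true, and_self, or_false]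
      by_cases hj : i = j
      · subst hj; simp
      · rw [if_neg (fun h => hj h.symm), if_neg hj]
  rw [hM, Matrix.det_diagonal, Fin.prod_univ_three]
  simp [Fin.ext_iff]

/-- `yScale` fixes the plane variables. -/
theorem subst_yScale_X_castSucc (γ : k) (i : Fin 2) :
    subst (yScale γ) (X (Fin.castSucc i) : MvPowerSeries (Fin 3) k) = X (Fin.castSucc i) := by
  rw [subst_X (hasSubst_of_constantCoeff_zero (constantCoeff_yScale γ)), yScale, if_neg (Fin.castSucc_lt_last i).ne]

/-- `yScale` fixes `u₁`. -/
theorem subst_yScale_X_zero (γ : k) : subst (yScale γ) (X 0 : MvPowerSeries (Fin 3) k) = X 0 :=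
  subst_yScale_X_castSucc γ 0

/-- `yScale` fixes `u₂`. -/
theorem subst_yScale_X_one (γ : k) : subst (yScale γ) (X 1 : MvPowerSeries (Fin 3) k) = X 1 :=
  subst_yScale_X_castSucc γ 1

/-- `yScale` fixes series renamed from the plane. -/
theorem subst_yScale_rename (γ : k) (F : MvPowerSeries (Fin 2) k) :
    subst (yScale γ) (rename (Fin.succAboveEmb (Fin.last 2)) F) = rename (Fin.succAboveEmb (Fin.last 2)) F := by
  rw [subst_rename_eq _ (yScale γ) (constantCoeff_yScale γ) F, rename_eq_subst]
  congr 1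
  funext i
  have hi : (Fin.succAboveEmb (Fin.last 2)) i = Fin.castSucc i := by
    rw [Fin.coe_succAboveEmb, Fin.succAbove_last]
  rw [Function.comp_apply, hi, yScale, if_neg (Fin.castSucc_lt_last i).ne]

/-- **THE `y`-SCALING ABSORBS THE POWERS `γ^{d−j}`**: `(y ↦ γ y)` maps `y^d + Σ γ^{d−j} T_j y^j` to `γ^d · (y^d + Σ T_j y^j)`. -/
theorem subst_yScale_monicGerm (γ : k) (d : ℕ) (T : Fin d → MvPowerSeries (Fin 2) k) :
    subst (yScale γ) (monicGerm d (fun j => C (γ ^ (d - (j : ℕ))) * T j)) = C (γ ^ d) * monicGerm d T := by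
  have hs := hasSubst_of_constantCoeff_zero (constantCoeff_yScale γ)
  have hY : subst (yScale γ) (X (Fin.last 2) : MvPowerSeries (Fin 3) k) = C γ * X (Fin.last 2) := by
    rw [subst_X hs, yScale, if_pos rfl]
  have rename_C' : ∀ a : k, rename (Fin.succAboveEmb (Fin.last 2)) (C a : MvPowerSeries (Fin 2) k) =
      (C a : MvPowerSeries (Fin 3) k) := fun a => by
    rw [← monomial_zero_eq_C_apply, rename_monomial, Finsupp.mapDomain_zero, monomial_zero_eq_C_apply]
  unfold monicGerm
  rw [← coe_substAlgHom hs, map_add, map_pow, map_sum, coe_substAlgHom, hY, mul_add, mul_pow, ← map_pow,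
    Finset.mul_sum]
  congr 1
  refine Finset.sum_congr rfl fun j _ => ?_
  rw [← coe_substAlgHom hs, map_mul, map_pow, coe_substAlgHom, subst_yScale_rename, hY, map_mul (rename _),
    rename_C', mul_pow, ← map_pow]
  have hjd : (j : ℕ) ≤ d := j.2.le
  have hγ : (γ ^ (d - (j : ℕ)) : k) * γ ^ (j : ℕ) = γ ^ d := by rw [← pow_add, Nat.sub_add_cancel hjd]
  calc C (γ ^ (d - (j : ℕ))) * rename (Fin.succAboveEmb (Fin.last 2)) (T j) * (C (γ ^ (j : ℕ)) * X (Fin.last 2) ^ (j : ℕ))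
      = C (γ ^ (d - (j : ℕ)) * γ ^ (j : ℕ)) * rename (Fin.succAboveEmb (Fin.last 2)) (T j) * X (Fin.last 2) ^ (j : ℕ) := by
        rw [map_mul]; ring
    _ = C (γ ^ d) * (rename (Fin.succAboveEmb (Fin.last 2)) (T j) * X (Fin.last 2) ^ (j : ℕ)) := by rw [hγ]; ring

/-! ## The extension of a plane change by `y ↦ y` -/

/-- The extension `Θ₁` of a plane coordinate change `τ` by `y ↦ y` (the family of `WildMonic.subst_extendLast_monicForm`). -/
def extendLast (τ : Fin 2 → MvPowerSeries (Fin 2) k) : Fin 3 → MvPowerSeries (Fin 3) k :=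
  fun l : Fin (2 + 1) => Fin.lastCases (motive := fun _ => MvPowerSeries (Fin (2 + 1)) k) (X (Fin.last 2))
    (fun i => rename (Fin.succAboveEmb (Fin.last 2)) (τ i)) l

/-- Its value on a plane variable. -/
theorem extendLast_castSucc (τ : Fin 2 → MvPowerSeries (Fin 2) k) (i : Fin 2) :
    extendLast τ (Fin.castSucc i) = rename (Fin.succAboveEmb (Fin.last 2)) (τ i) :=
  WildPurePower.extendLast_apply_castSucc (m := 2) τ i

/-- Its value on `u₁`. -/
theorem extendLast_zero (τ : Fin 2 → MvPowerSeries (Fin 2) k) :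
    extendLast τ 0 = rename (Fin.succAboveEmb (Fin.last 2)) (τ 0) :=
  extendLast_castSucc τ 0

/-- Its value on `u₂`. -/
theorem extendLast_one (τ : Fin 2 → MvPowerSeries (Fin 2) k) :
    extendLast τ 1 = rename (Fin.succAboveEmb (Fin.last 2)) (τ 1) :=
  extendLast_castSucc τ 1

/-- Zero constant terms. -/
theorem constantCoeff_extendLast' (τ : Fin 2 → MvPowerSeries (Fin 2) k) (hτ : ∀ i, constantCoeff (τ i) = 0) (l : Fin 3) :
    constantCoeff (extendLast τ l) = 0 :=
  WildPurePower.constantCoeff_extendLast (m := 2) τ hτ l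

/-- Determinant of the linear part. -/
theorem det_linMat_extendLast (τ : Fin 2 → MvPowerSeries (Fin 2) k) :
    (FormalCoordChange.linMat (extendLast τ)).det = (FormalCoordChange.linMat τ).det :=
  WildPurePower.linMat_extendLast_det (m := 2) τ

/-- Action on monic germs: coefficientwise. -/
theorem subst_extendLast_monicGerm (τ : Fin 2 → MvPowerSeries (Fin 2) k) (hτ : ∀ i, constantCoeff (τ i) = 0) (d : ℕ)
    (S : Fin d → MvPowerSeries (Fin 2) k) :
    subst (extendLast τ) (monicGerm d S) = monicGerm d (fun j => subst τ (S j)) :=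
  WildMonic.subst_extendLast_monicForm (m := 2) τ hτ S

/-- `rename` of `C a * X i` from the plane. -/
theorem rename_C_mul_X (a : k) (i : Fin 2) :
    rename (Fin.succAboveEmb (Fin.last 2)) (C a * X i : MvPowerSeries (Fin 2) k) = C a * X (Fin.castSucc i) := by
  rw [map_mul, rename_X]
  have hC : rename (Fin.succAboveEmb (Fin.last 2)) (C a : MvPowerSeries (Fin 2) k) = (C a : MvPowerSeries (Fin 3) k) := by
    rw [← monomial_zero_eq_C_apply, rename_monomial, Finsupp.mapDomain_zero, monomial_zero_eq_C_apply]
  rw [hC]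
  congr 2
  rw [Fin.coe_succAboveEmb, Fin.succAbove_last]

/-- `rename (C a * X 0) = C a * X 0`. -/
theorem rename_C_mul_X_zero (a : k) :
    rename (Fin.succAboveEmb (Fin.last 2)) (C a * X 0 : MvPowerSeries (Fin 2) k) = C a * X 0 :=
  rename_C_mul_X a 0

/-- `rename (C a * X 1) = C a * X 1`. -/
theorem rename_C_mul_X_one (a : k) :
    rename (Fin.succAboveEmb (Fin.last 2)) (C a * X 1 : MvPowerSeries (Fin 2) k) = C a * X 1 :=
  rename_C_mul_X a 1

end NCPoly

end Summit.ResolutionOfSingularities.ResolutionOfSingularities.Theorems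

end
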